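import Literature.Computability.Complexity.HardcoreInapproximabilitySecondMomentColour
import HarnessLib

/-!
# The overlap-count factor of the second-moment ratio

`A(g,h) = C(a,g)C(n-a,a-g)C(b,h)C(n-b,b-h)/(C(n,a)C(n,b))` (`slyAcoef`) is the probability that two
uniform configurations of densities `(a, b)` have overlaps `(g, h)`; its rate is `f_A = slyFA`
(`slyAcoef_entropy_eq`). Bounds: `slyAcoef_le` (everywhere) and the two-sided Stirling form
`log_slyAcoef_interior` (prefactor `slyPrefA`). Companion of `…SecondMomentColour`.

## References
* [MosselWeitzWormald2008] E. Mossel, D. Weitz, N. Wormald, PTRF 143 (2009), §5.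
* [Sly2010] A. Sly, FOCS 2010 / arXiv:1005.5584, §3.2 (proof of Lemma 3.5).
-/

namespace Literature.Computability.Complexity

open Real Finset Literature.Analysis.SpecialFunctions

section Defs

/-- **The overlap-count factor** `A(g,h) = C(a,g)C(n-a,a-g)C(b,h)C(n-b,b-h)/(C(n,a)C(n,b))`: the
probability that two uniform configurations of densities `(a, b)` have overlaps `(g, h)`.
[cite: MosselWeitzWormald2008, §5 (the first factor of `E[(Z^{α,β})²]`); Sly2010, proof of Lemma 3.5] -/
noncomputable def slyAcoef (n a b g h : ℕ) : ℝ :=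
  (a.choose g : ℝ) * ((n - a).choose (a - g) : ℝ) * ((b.choose h : ℝ) * ((n - b).choose (b - h) : ℝ)) /
    ((n.choose a : ℝ) * (n.choose b : ℝ))

/-- The prefactor exponent of `A(g,h)` (six binomials). [folklore] -/
noncomputable def slyPrefA (α β γ δ : ℝ) : ℝ :=
  (Real.log α - Real.log γ - Real.log (α - γ)) +
    (Real.log (1 - α) - Real.log (α - γ) - Real.log (1 - α - (α - γ))) -
    (Real.log 1 - Real.log α - Real.log (1 - α)) +
    ((Real.log β - Real.log δ - Real.log (β - δ)) +
      (Real.log (1 - β) - Real.log (β - δ) - Real.log (1 - β - (β - δ))) -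
      (Real.log 1 - Real.log β - Real.log (1 - β)))

end Defs

section Bounds

variable {n a b g h : ℕ}

/-- **The entropy identity of the overlap factor**: the signed entropy forms of the six binomials add
up to `n · f_A(a/n, b/n, g/n, h/n)` (`f_A = slyFA = slyRate 0`). [cite: MosselWeitzWormald2008, §5] -/
theorem slyAcoef_entropy_eq (hn : 0 < n) (hga : g ≤ a) (hhb : h ≤ b) (han : a ≤ n) (hbn : b ≤ n) :
    entB (a : ℝ) g + entB ((n - a : ℕ) : ℝ) ((a - g : ℕ) : ℝ) - entB (n : ℝ) a +
      (entB (b : ℝ) h + entB ((n - b : ℕ) : ℝ) ((b - h : ℕ) : ℝ) - entB (n : ℝ) b) =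
      n * slyFA (a / n) (b / n) (g / n) (h / n) := by
  have hnR : (0 : ℝ) < n := by exact_mod_cast hn
  have c1 : ((n - a : ℕ) : ℝ) = n * (1 - a / n) := by rw [Nat.cast_sub han]; field_simp
  have c2 : ((a - g : ℕ) : ℝ) = n * (a / n - g / n) := by rw [Nat.cast_sub hga]; field_simp
  have c3 : ((n - b : ℕ) : ℝ) = n * (1 - b / n) := by rw [Nat.cast_sub hbn]; field_simp
  have c4 : ((b - h : ℕ) : ℝ) = n * (b / n - h / n) := by rw [Nat.cast_sub hhb]; field_simp
  have ca : (a : ℝ) = n * (a / n) := by field_simp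
  have cb : (b : ℝ) = n * (b / n) := by field_simp
  have cg : (g : ℝ) = n * (g / n) := by field_simp
  have ch : (h : ℝ) = n * (h / n) := by field_simp
  have E1 : entB (a : ℝ) g = n * entB (a / n) (g / n) := by
    conv_lhs => rw [ca, cg]
    exact entB_mul hnR _ _
  have E2 : entB ((n - a : ℕ) : ℝ) ((a - g : ℕ) : ℝ) = n * entB (1 - a / n) (a / n - g / n) := by
    rw [c1, c2]; exact entB_mul hnR _ _
  have E3 : entB (n : ℝ) a = n * entB 1 (a / n) := by
    rw [← entB_mul hnR, mul_one]; congr 1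
  have E4 : entB (b : ℝ) h = n * entB (b / n) (h / n) := by
    conv_lhs => rw [cb, ch]
    exact entB_mul hnR _ _
  have E5 : entB ((n - b : ℕ) : ℝ) ((b - h : ℕ) : ℝ) = n * entB (1 - b / n) (b / n - h / n) := by
    rw [c3, c4]; exact entB_mul hnR _ _
  have E6 : entB (n : ℝ) b = n * entB 1 (b / n) := by
    rw [← entB_mul hnR, mul_one]; congr 1
  rw [E1, E2, E3, E4, E5, E6]
  unfold slyFA
  ring

/-- **Upper bound for the overlap factor, everywhere**: `A(g,h) ≤ exp(n f_A + 2((log n)/2 + 2))`.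
[folklore] -/
theorem slyAcoef_le (hn : 1 ≤ n) (hga : g ≤ a) (hhb : h ≤ b) (han : a ≤ n) (hbn : b ≤ n) :
    slyAcoef n a b g h ≤
      Real.exp (n * slyFA (a / n) (b / n) (g / n) (h / n) + 2 * (Real.log n / 2 + 2)) := by
  by_cases h1 : a - g ≤ n - a
  swap
  · have : ((n - a).choose (a - g) : ℝ) = 0 := by exact_mod_cast Nat.choose_eq_zero_of_lt (by omega)
    have hz : slyAcoef n a b g h = 0 := by unfold slyAcoef; rw [this]; ring
    rw [hz]; exact (Real.exp_pos _).le
  by_cases h2 : b - h ≤ n - b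
  swap
  · have : ((n - b).choose (b - h) : ℝ) = 0 := by exact_mod_cast Nat.choose_eq_zero_of_lt (by omega)
    have hz : slyAcoef n a b g h = 0 := by unfold slyAcoef; rw [this]; ring
    rw [hz]; exact (Real.exp_pos _).le
  have p1 : 0 < (a.choose g : ℝ) := by exact_mod_cast Nat.choose_pos hga
  have p2 : 0 < ((n - a).choose (a - g) : ℝ) := by exact_mod_cast Nat.choose_pos h1
  have p3 : 0 < (b.choose h : ℝ) := by exact_mod_cast Nat.choose_pos hhb
  have p4 : 0 < ((n - b).choose (b - h) : ℝ) := by exact_mod_cast Nat.choose_pos h2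
  have p5 : 0 < (n.choose a : ℝ) := by exact_mod_cast Nat.choose_pos han
  have p6 : 0 < (n.choose b : ℝ) := by exact_mod_cast Nat.choose_pos hbn
  have hpos : 0 < slyAcoef n a b g h := by unfold slyAcoef; positivity
  rw [← Real.exp_log hpos, Real.exp_le_exp]
  have hlog : Real.log (slyAcoef n a b g h) =
      Real.log (a.choose g) + Real.log ((n - a).choose (a - g)) +
        (Real.log (b.choose h) + Real.log ((n - b).choose (b - h))) -
        (Real.log (n.choose a) + Real.log (n.choose b)) := by
    unfold slyAcoef
    rw [Real.log_div (by positivity) (by positivity), Real.log_mul (by positivity) (by positivity),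
      Real.log_mul p1.ne' p2.ne', Real.log_mul p3.ne' p4.ne', Real.log_mul p5.ne' p6.ne']
  rw [hlog]
  have u1 := log_choose_le_entB hga
  have u2 := log_choose_le_entB h1
  have u3 := log_choose_le_entB hhb
  have u4 := log_choose_le_entB h2
  have l5 := entB_sub_le_log_choose hn han
  have l6 := entB_sub_le_log_choose hn hbn
  have hid := slyAcoef_entropy_eq (lt_of_lt_of_le Nat.zero_lt_one hn) hga hhb han hbn
  linarith

set_option maxHeartbeats 1600000 in
/-- **Two-sided Stirling form of the overlap factor in the interior**:
`log A(g,h) = n f_A + (Pref_A - 2 log(2πn))/2 + Θ`, `|Θ| ≤ 2/μ`, when all six binomials have lower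
index and complement at least `μ`. [folklore] -/
theorem log_slyAcoef_interior (hga : g ≤ a) (hhb : h ≤ b) (han : a ≤ n) (hbn : b ≤ n) {μ : ℕ}
    (hμ : 1 ≤ μ) (k1 : μ ≤ g) (k1' : g + μ ≤ a) (k2' : a - g + μ ≤ n - a)
    (k3 : μ ≤ h) (k3' : h + μ ≤ b) (k4' : b - h + μ ≤ n - b) :
    |Real.log (slyAcoef n a b g h) -
        (n * slyFA (a / n) (b / n) (g / n) (h / n) +
          (slyPrefA (a / n) (b / n) (g / n) (h / n) - 2 * Real.log (2 * π * n)) / 2)| ≤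
      2 / (μ : ℝ) := by
  have hn : 0 < n := by omega
  have hnR : (0 : ℝ) < n := by exact_mod_cast hn
  have hμR : (1 : ℝ) ≤ μ := by exact_mod_cast hμ
  obtain ⟨θ1, l1, u1, e1⟩ := log_choose_eq_stirling (m := a) (k := g) (by omega) (by omega)
  obtain ⟨θ2, l2, u2, e2⟩ := log_choose_eq_stirling (m := n - a) (k := a - g) (by omega) (by omega)
  obtain ⟨θ3, l3, u3, e3⟩ := log_choose_eq_stirling (m := b) (k := h) (by omega) (by omega)
  obtain ⟨θ4, l4, u4, e4⟩ := log_choose_eq_stirling (m := n - b) (k := b - h) (by omega) (by omega)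
  obtain ⟨θ5, l5, u5, e5⟩ := log_choose_eq_stirling (m := n) (k := a) (by omega) (by omega)
  obtain ⟨θ6, l6, u6, e6⟩ := log_choose_eq_stirling (m := n) (k := b) (by omega) (by omega)
  have p1 : 0 < (a.choose g : ℝ) := by exact_mod_cast Nat.choose_pos hga
  have p2 : 0 < ((n - a).choose (a - g) : ℝ) := by exact_mod_cast Nat.choose_pos (by omega)
  have p3 : 0 < (b.choose h : ℝ) := by exact_mod_cast Nat.choose_pos hhb
  have p4 : 0 < ((n - b).choose (b - h) : ℝ) := by exact_mod_cast Nat.choose_pos (by omega)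
  have p5 : 0 < (n.choose a : ℝ) := by exact_mod_cast Nat.choose_pos han
  have p6 : 0 < (n.choose b : ℝ) := by exact_mod_cast Nat.choose_pos hbn
  have hlog : Real.log (slyAcoef n a b g h) =
      Real.log (a.choose g) + Real.log ((n - a).choose (a - g)) +
        (Real.log (b.choose h) + Real.log ((n - b).choose (b - h))) -
        (Real.log (n.choose a) + Real.log (n.choose b)) := by
    unfold slyAcoef
    rw [Real.log_div (by positivity) (by positivity), Real.log_mul (by positivity) (by positivity),
      Real.log_mul p1.ne' p2.ne', Real.log_mul p3.ne' p4.ne', Real.log_mul p5.ne' p6.ne']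
  have hid := slyAcoef_entropy_eq hn hga hhb han hbn
  -- densities
  have c1 : ((n - a : ℕ) : ℝ) = n * (1 - a / n) := by rw [Nat.cast_sub han]; field_simp
  have c2 : ((a - g : ℕ) : ℝ) = n * (a / n - g / n) := by rw [Nat.cast_sub hga]; field_simp
  have c3 : ((n - b : ℕ) : ℝ) = n * (1 - b / n) := by rw [Nat.cast_sub hbn]; field_simp
  have c4 : ((b - h : ℕ) : ℝ) = n * (b / n - h / n) := by rw [Nat.cast_sub hhb]; field_simp
  have ca : (a : ℝ) = n * (a / n) := by field_simp
  have cb : (b : ℝ) = n * (b / n) := by field_simp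
  have cg : (g : ℝ) = n * (g / n) := by field_simp
  have ch : (h : ℝ) = n * (h / n) := by field_simp
  have da : (0 : ℝ) < a / n := by
    have : (0 : ℝ) < a := by exact_mod_cast (by omega : 0 < a)
    positivity
  have db : (0 : ℝ) < b / n := by
    have : (0 : ℝ) < b := by exact_mod_cast (by omega : 0 < b)
    positivity
  have dg : (0 : ℝ) < g / n := by
    have : (0 : ℝ) < g := by exact_mod_cast (by omega : 0 < g)
    positivity
  have dh : (0 : ℝ) < h / n := by
    have : (0 : ℝ) < h := by exact_mod_cast (by omega : 0 < h)
    positivity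
  have dga : g / (n : ℝ) < a / n := by
    have : (n : ℝ) * (g / n) < n * (a / n) := by rw [← cg, ← ca]; exact_mod_cast (by omega : g < a)
    exact lt_of_mul_lt_mul_left this hnR.le
  have dhb : h / (n : ℝ) < b / n := by
    have : (n : ℝ) * (h / n) < n * (b / n) := by rw [← ch, ← cb]; exact_mod_cast (by omega : h < b)
    exact lt_of_mul_lt_mul_left this hnR.le
  have dP : (0 : ℝ) < a / n - g / n := by linarith
  have dA : (0 : ℝ) < b / n - h / n := by linarith
  have dPn : a / (n : ℝ) - g / n < 1 - a / n := by
    have : (n : ℝ) * (a / n - g / n) < n * (1 - a / n) := by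
      rw [← c2, ← c1]; exact_mod_cast (by omega : a - g < n - a)
    exact lt_of_mul_lt_mul_left this hnR.le
  have dAn : b / (n : ℝ) - h / n < 1 - b / n := by
    have : (n : ℝ) * (b / n - h / n) < n * (1 - b / n) := by
      rw [← c4, ← c3]; exact_mod_cast (by omega : b - h < n - b)
    exact lt_of_mul_lt_mul_left this hnR.le
  have dan : a / (n : ℝ) < 1 := by rw [div_lt_one hnR]; exact_mod_cast (by omega : a < n)
  have dbn : b / (n : ℝ) < 1 := by rw [div_lt_one hnR]; exact_mod_cast (by omega : b < n)
  have P1 := log_pref_scaled hnR da dg dga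
  have P2 := log_pref_scaled hnR (by linarith) dP dPn
  have P3 := log_pref_scaled hnR db dh dhb
  have P4 := log_pref_scaled hnR (by linarith) dA dAn
  have P5 := log_pref_scaled hnR one_pos da dan
  have P6 := log_pref_scaled hnR one_pos db dbn
  rw [← ca, ← cg] at P1
  rw [← c1, ← c2] at P2
  rw [← cb, ← ch] at P3
  rw [← c3, ← c4] at P4
  rw [mul_one, ← ca] at P5
  rw [mul_one, ← cb] at P6
  have h2π : Real.log (2 * π * n) = Real.log (2 * π) + Real.log n :=
    Real.log_mul (by positivity) hnR.ne'
  have hΘ : Real.log (slyAcoef n a b g h) -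
      (n * slyFA (a / n) (b / n) (g / n) (h / n) +
        (slyPrefA (a / n) (b / n) (g / n) (h / n) - 2 * Real.log (2 * π * n)) / 2) =
      θ1 + θ2 + θ3 + θ4 - θ5 - θ6 := by
    rw [hlog, ← hid, h2π]
    unfold slyPrefA entB
    simp only [Real.log_one] at P5 P6 ⊢
    linear_combination (e1 + e2 + e3 + e4 - e5 - e6) + (1 / 2 : ℝ) * (P1 + P2 + P3 + P4 - P5 - P6)
  -- the error bound
  have hμk : ∀ {k : ℕ}, μ ≤ k → 1 / (12 * (k : ℝ)) ≤ 1 / (12 * (μ : ℝ)) := by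
    intro k hk
    exact one_div_le_one_div_of_le (by positivity) (by
      have : (μ : ℝ) ≤ k := by exact_mod_cast hk
      linarith)
  have hμk' : ∀ {m k : ℕ}, k + μ ≤ m → 1 / (12 * ((m : ℝ) - k)) ≤ 1 / (12 * (μ : ℝ)) := by
    intro m k hk
    exact one_div_le_one_div_of_le (by positivity) (by
      have : ((k : ℝ) + μ) ≤ m := by exact_mod_cast hk
      linarith)
  have b1 := hμk k1; have b1' := hμk' k1'; have b1m := hμk (k := a) (by omega)
  have b2 := hμk (k := a - g) (by omega); have b2' := hμk' k2'
  have b2m := hμk (k := n - a) (by omega)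
  have b3 := hμk k3; have b3' := hμk' k3'; have b3m := hμk (k := b) (by omega)
  have b4 := hμk (k := b - h) (by omega); have b4' := hμk' k4'
  have b4m := hμk (k := n - b) (by omega)
  have b5 := hμk (k := a) (by omega); have b5' := hμk' (m := n) (k := a) (by omega)
  have b5m := hμk (k := n) (by omega)
  have b6 := hμk (k := b) (by omega); have b6' := hμk' (m := n) (k := b) (by omega)
  have ht : (0 : ℝ) ≤ 1 / (12 * (μ : ℝ)) := by positivity
  have hconv : (2 : ℝ) / (μ : ℝ) = 24 * (1 / (12 * (μ : ℝ))) := by field_simp; ring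
  rw [hΘ, hconv, abs_le]
  constructor
  · linarith only [l1, l2, l3, l4, u5, u6, b1, b1', b2, b2', b3, b3', b4, b4', b5m, ht]
  · linarith only [u1, u2, u3, u4, l5, l6, b1m, b2m, b3m, b4m, b5, b5', b6, b6', ht]

end Bounds

end Literature.Computability.Complexity
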